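/-
Copyright (c) 2026 the pub-hodgecm-mathlib formalisation cell (harness21).  Prover seat hodgecm-mathlib-F0P2-p11 (g2) (L1; LEAD F0P6-plan (g14) «(o1) KIND 1», memo
`CENSUS-K1-DealTable` brick (T4-β), the LINE CHART), Track B «K2-LIT» ∕ hLiu418 #184♮, ROAD Φ, G5-b: THE CORNER UNIPOTENT ONE-PARAMETER SUBGROUP `nB : 𝔸_{L⁺} → N_Δ(𝔸)` OF
THE DOUBLED LINE with coordinate `(t ⊗ 1)·δ`, and the identification of ★ p861153's corner line `n₂` with `blkD (1, nB ·)`.  THEOREMS ONLY.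
-/
import Summits.HodgeConjecture.HodgeConjecture.Theorems.K2LiuCornerLineChartTwo            -- ★ p862584 (T4-α) part 3 (+ ★ p862538, ★ `blkD`)
import Summits.HodgeConjecture.HodgeConjecture.Theorems.K2LiuUnipDeltaCornerCoordinates     -- ★ `conjAdele_baseChange_mul_delta`, `continuous_baseChange_mul_delta` (+ ★ `exists_unipChart`)
import HarnessLib

/-!
# Crux `HLiu418`, KIND 1, brick (T4-β): the line chart `nB` of the doubled LINE and `n₂ t = blkD (1, nB t)`

Cell `hodgecm-mathlib`, crux item hLiu418 = `stmt-HodgeConjecture-24832` (helper lane, count-neutral); squad K2 ∕ K2Liu, LEAD F0P6-plan (g14); prover F0P2-p11 (g2).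
THEOREMS ONLY (no `def`, no `instance`, no notation, no named-fact hypothesis, no `sorry`).

★ p862629 `cornerLine_integral_eq_whittakerDelta_line` takes BY VALUE a line chart `nB : 𝔸_{L⁺} → N_Δ⁽ᴮ⁾(𝔸)` and the presentation `n₂ t = blkD (1, nB t)` of the corner line.
THIS FILE supplies both:
* §1 **`exists_lineChart`** — for the doubled LINE datum `(eB : Fin 1 × Fin 1 ≃ Fin n₂, dB, dW)`: a CONTINUOUS one-parameter subgroup `nB : 𝔸_{L⁺} → N_Δ⁽ᴮ⁾(𝔸)`,
  `nB (s + t) = nB s · nB t`, with corner coordinate `X(nB t) = ((t ⊗ 1)·δ)·𝟙` (`δ = imagUnit L`; ★ `exists_unipChart` at the line, the constant matrix `(t ⊗ 1)δ` being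
  `T`-skew because `σ((t ⊗ 1)δ) = −(t ⊗ 1)δ` ★ `conjAdele_baseChange_mul_delta` and `Fin n₂` is a singleton).
* §2 **`cornerLine_eq_blkD_lineChart`** — at `n = 2` under the corner hypothesis `he : e (1, 0) = 1`: ANY corner line `n₂` of ★ p861153's shape (`n₂ t ∈ N_Δ(𝔸)`,
  `X(n₂ t) = single 1 1 ((t ⊗ 1)δ)`) IS `blkD (1, nB t)` for ANY line chart `nB` of §1's shape (★ p862584 `eq_of_mem_unipDelta_of_toBlocks₁₂_eq` + `blk_blkD_one_inr_toBlocks₁₂_two`).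
⇒ with ★ p862629: ★ p861327's corner-line integral = `whittakerDelta⁽ᴮ⁾ (nB_* μ) S'₂₂ (f (blkD (1, ·) · g)) 1` with NO chart hypothesis left — (T4) «corner line = carrier A» ★.
What remains BY VALUE for K1-b♮: that `nB_* μ` is a Haar measure of `N_Δ⁽ᴮ⁾(𝔸)` (the chart is a topological isomorphism `𝔸_{L⁺} ≅ N_Δ⁽ᴮ⁾(𝔸)`; ★ `smul_whittakerDelta_carrier_eq` then
absorbs the scalar) and the KIND-W machinery at `n := 1` ((K1b-W)).
HONEST LABEL.  Count-neutral helper; `HC_CM` is proved only modulo the 7 printed citations (2 remaining named inputs: hLiu418 = `stmt-HodgeConjecture-24832`,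
h413 = `stmt-HodgeConjecture-24833`) until rung 0 closes.

## References
* [KudlaRallis1994] S. Kudla, S. Rallis, Ann. of Math. 140 (1994), §2 (2.10)–(2.12).
* [Kudla1994] S. Kudla, Israel J. Math. 87 (1994), §2.
* [MoeglinWaldspurger1995] C. Mœglin, J.-L. Waldspurger, CUP (1995), I.2.1, II.1.7.
* [GelbartPiatetskishapiroRallis1987] LNM 1254 (1987), Part A §1.
-/

set_option autoImplicit false
set_option linter.dupNamespace false -- the mandated namespace repeats `HodgeConjecture.HodgeConjecture`

noncomputable section

open scoped Matrix
open NumberField IsDedekindDomain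
open Literature.NumberTheory.Automorphic Literature.NumberTheory.Automorphic.UnitaryGroup Literature.NumberTheory.GaloisRepresentations
open Literature.NumberTheory.GelbartRogawski1991 Literature.NumberTheory.GelbartRogawski1991.GRConstruction
open Literature.NumberTheory.K2Lit.SiegelDoubled
open UnitaryDualPair

namespace Summit.HodgeConjecture.HodgeConjecture.Cruxes.HLiu418.K2LiuLineCornerChart

open K2LiuSiegelUnipotentFourierDefs K2LiuBlockDiagUnipotentChart K2LiuCornerLineChartTwo K2LiuUnipotentChart K2LiuUnipDeltaCornerCoordinates

variable (L : Type) [Field L] [NumberField L] [IsCMField L]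

/-! ## §1 The line chart -/

section Line

variable {n₂ : ℕ} (eB : Fin 1 × Fin 1 ≃ Fin n₂) (dB : Fin 1 → L) (hdB : ∀ i, IsCMField.complexConj L (dB i) = dB i)
  (dW : Fin 1 → L) (hdW : ∀ i, IsCMField.complexConj L (dW i) = dW i)

include eB in
/-- on a singleton index type every square matrix is a scalar multiple of `𝟙`, so two constant-coefficient expressions commute: the `T`-skewness of the constant
matrix `c·𝟙` reduces to `c + σ(c) = 0`. [folklore] -/
theorem skew_of_const (T : Matrix (Fin n₂) (Fin n₂) (AdeleRing (𝓞 L) L)) {c : AdeleRing (𝓞 L) L}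
    (hc : conjAdele (Fp L) L (IsCMField.complexConj L) c = -c) :
    T * Matrix.of (fun _ _ => c) + ((Matrix.of fun (_ : Fin n₂) (_ : Fin n₂) => c).map (conjAdele (Fp L) L (IsCMField.complexConj L)))ᵀ * T = 0 := by
  haveI : Unique (Fin n₂) := ⟨⟨eB (0, 0)⟩, fun m => eq_eB eB m⟩
  ext i j
  obtain rfl : i = default := Subsingleton.elim _ _
  obtain rfl : j = default := Subsingleton.elim _ _
  simp [Matrix.mul_apply, hc, mul_comm]

/-- **THE LINE CHART.**  For the doubled LINE datum `(eB, dB, dW)` there is a continuous one-parameter subgroup `nB : 𝔸_{L⁺} → N_Δ(𝔸)` with corner coordinate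
`X(nB t) = ((t ⊗ 1)·δ)·𝟙`, `δ = imagUnit L` (★ `exists_unipChart`; the constant matrix is `T`-skew by `skew_of_const` and ★ `conjAdele_baseChange_mul_delta`).
[cite: MoeglinWaldspurger1995, I.2.1] [cite: GelbartPiatetskishapiroRallis1987, Part A §1] -/
theorem exists_lineChart :
    ∃ nB : AdeleRing (𝓞 (Fp L)) (Fp L) → unipDelta L eB dB hdB dW hdW,
      Continuous nB ∧ (∀ s t, nB (s + t) = nB s * nB t) ∧
      ∀ t, (blk L eB dB hdB dW hdW (nB t : HA L eB dB hdB dW hdW)).toBlocks₁₂ =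
        Matrix.of fun _ _ => AdeleRing.baseChange (Fp L) L t * algebraMap L (AdeleRing (𝓞 L) L) (imagUnit L) := by
  classical
  obtain ⟨φ, hφc, hφadd, hφskew, -, -⟩ := exists_unipChart L eB dB hdB dW hdW
  set X : AdeleRing (𝓞 (Fp L)) (Fp L) → Matrix (Fin n₂) (Fin n₂) (AdeleRing (𝓞 L) L) :=
    fun t => Matrix.of fun _ _ => AdeleRing.baseChange (Fp L) L t * algebraMap L (AdeleRing (𝓞 L) L) (imagUnit L) with hX
  have hskew : ∀ t, (gramR L eB dB hdB dW hdW).map ((algebraMap L (AdeleRing (𝓞 L) L)).comp (algebraMap (Fp L) L)) * X t +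
      ((X t).map (conjAdele (Fp L) L (IsCMField.complexConj L)))ᵀ *
        (gramR L eB dB hdB dW hdW).map ((algebraMap L (AdeleRing (𝓞 L) L)).comp (algebraMap (Fp L) L)) = 0 :=
    fun t => skew_of_const L eB _ (conjAdele_baseChange_mul_delta L t)
  have hmem := fun t => hφskew (X t) (hskew t)
  have hXc : Continuous X := continuous_pi fun _ => continuous_pi fun _ => continuous_baseChange_mul_delta L
  refine ⟨fun t => ⟨⟨φ (X t), (hmem t).choose⟩, (hmem t).choose_spec.1⟩, ?_, ?_, ?_⟩
  · exact ((hφc.comp hXc).subtype_mk _).subtype_mk _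
  · intro s t
    apply Subtype.ext
    apply Subtype.ext
    show φ (X (s + t)) = φ (X s) * φ (X t)
    rw [← hφadd]
    congr 1
    ext i j
    simp [hX, map_add, add_mul]
  · intro t
    have hfr := (hmem t).choose_spec.2
    have hfr' := (mem_unipDelta_iff_conj L eB dB hdB dW hdW _).1 (hmem t).choose_spec.1
    exact (Matrix.fromBlocks_inj.1 (hfr'.symm.trans hfr)).2.1

end Line

/-! ## §2 `n = 2`: the corner line of the rank-one files is `blkD (1, nB ·)` -/

variable {n₁ n₂ : ℕ} (e : Fin (1 + 1) × Fin 1 ≃ Fin 2) (eA : Fin 1 × Fin 1 ≃ Fin n₁) (eB : Fin 1 × Fin 1 ≃ Fin n₂)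
  (dA : Fin 1 → L) (hdA : ∀ i, IsCMField.complexConj L (dA i) = dA i)
  (dB : Fin 1 → L) (hdB : ∀ i, IsCMField.complexConj L (dB i) = dB i)
  (dV : Fin (1 + 1) → L) (hdV : ∀ i, IsCMField.complexConj L (dV i) = dV i)
  (hVA : ∀ i, dV (Fin.castAdd 1 i) = dA i) (hVB : ∀ j, dV (Fin.natAdd 1 j) = dB j)
  (dW : Fin 1 → L) (hdW : ∀ i, IsCMField.complexConj L (dW i) = dW i)

/-- **`n₂ t = blkD (1, nB t)`**: at `n = 2` under the corner hypothesis, a corner line of ★ p861153's shape (values in `N_Δ(𝔸)`, coordinate `single 1 1 ((t ⊗ 1)δ)`) coincides with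
the image of any line chart of §1's shape (`N_Δ` elements are determined by their corner coordinate, ★ p862584). [cite: KudlaRallis1994, §2 (2.10)–(2.12)] [cite: Kudla1994, §2] -/
theorem cornerLine_eq_blkD_lineChart (he : e (1, 0) = 1)
    (nB : AdeleRing (𝓞 (Fp L)) (Fp L) → unipDelta L eB dB hdB dW hdW)
    (hnB : ∀ t, (blk L eB dB hdB dW hdW (nB t : HA L eB dB hdB dW hdW)).toBlocks₁₂ =
      Matrix.of fun _ _ => AdeleRing.baseChange (Fp L) L t * algebraMap L (AdeleRing (𝓞 L) L) (imagUnit L))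
    (n₂ : AdeleRing (𝓞 (Fp L)) (Fp L) → HA L e dV hdV dW hdW) (hn₂mem : ∀ t, n₂ t ∈ unipDelta L e dV hdV dW hdW)
    (hn₂X : ∀ t, (blk L e dV hdV dW hdW (n₂ t)).toBlocks₁₂ =
      Matrix.single (1 : Fin 2) (1 : Fin 2) (AdeleRing.baseChange (Fp L) L t * algebraMap L (AdeleRing (𝓞 L) L) (imagUnit L)))
    (t : AdeleRing (𝓞 (Fp L)) (Fp L)) :
    n₂ t = blkD L e eA eB dA hdA dB hdB dV hdV hVA hVB dW hdW (1, ((nB t : unipDelta L eB dB hdB dW hdW) : HA L eB dB hdB dW hdW)) := by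
  refine eq_of_mem_unipDelta_of_toBlocks₁₂_eq L e dV hdV dW hdW (hn₂mem t)
    (blkD_one_inr_mem_unipDelta L e eA eB dA hdA dB hdB dV hdV hVA hVB dW hdW (nB t).2) ?_
  rw [hn₂X, blk_blkD_one_inr_toBlocks₁₂_two L e eA eB dA hdA dB hdB dV hdV hVA hVB dW hdW he, hnB]
  rfl

end Summit.HodgeConjecture.HodgeConjecture.Cruxes.HLiu418.K2LiuLineCornerChart

end
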